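import Mathlib
import Literature.Barriers.ValiantsHypothesis.MonotoneGap
import Literature.Computability.AlgebraicComplexity.ArithCircuitProofs

/-!
# Hrubeš's bridge (route `CirculantFourier`, item `HrubesBridge`), part A: plain gate lists

Support file for item `stmt-ValiantsHypothesis-6309`
(`Summit.ValiantsHypothesis.ValiantsHypothesis.Theses.CirculantFourier.HrubesBridge`, Hrubeš 2020,
*On ε-sensitive monotone computations*, Thm. 1, rendered in the tree's plain monotone model
`Literature.Barriers.ValiantsHypothesis.IsMonotoneComputation`).

This part is pure bookkeeping for building plain fan-in-two circuits over `ℝ≥0` incrementally, as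
GATE LISTS `gs : List (Gate ℝ≥0 σ)`:

* `Good[gs]` (local notation): every gate has fan-in `≤ 2` and is plain (sum coefficients `1`);
* `Av[gs, a]` (local notation): the polynomial `a` is *available* after `gs` — some operand that
  refers only to gates of `gs` evaluates to `a` against `gateValues gs`. Availability is stable
  under appending gates (`av_mono`), variables and constants are always available, and one new
  plain gate makes `a + b` resp. `a * b` available (`ext_add`, `ext_mul`);
* iterated forms (`ext_sum`, `ext_iter`, `ext_pow`, `ext_mul_add`) with explicit gate counts;
* `extract`: an available polynomial is computed by a monotone computation of size `gs.length`;
* the product rule for homogeneous components `(p q)_k = Σ_{a ≤ k} p_a q_{k-a}`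
  (`homogeneousComponent_mul_eq_sum`), used for product gates in part B.

No definitions are introduced (local notations only).
-/

noncomputable section

-- `Summit.ValiantsHypothesis.ValiantsHypothesis.…` is the tree's mandated layout (Sub = Summit).
set_option linter.dupNamespace false

namespace Summit.ValiantsHypothesis.ValiantsHypothesis.Theorems.CirculantFourierHrubes

open MvPolynomial Literature.Computability.AlgebraicComplexity ArithCircuit
  Literature.Barriers.ValiantsHypothesis
open scoped NNReal

variable {σ : Type*}

/-- `Good[gs]` (local notation, not a definition): every gate of `gs` has fan-in `≤ 2` and is
plain. -/
local notation3 (prettyPrint := false) "Good[" gs "]" =>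
  ∀ g ∈ (gs : List (Gate ℝ≥0 _)), Gate.fanIn g ≤ 2 ∧ IsPlainGate g

/-- `Av[gs, a]` (local notation, not a definition): some operand referring only to gates of `gs`
evaluates to `a` against the values of `gs`. -/
local notation3 (prettyPrint := false) "Av[" gs ", " a "]" =>
  ∃ u : Operand ℝ≥0 _, Operand.RefsBelow (List.length gs) u ∧ Operand.eval (gateValues gs) u = a

/-- The values of a longer gate list extend the values of a prefix. -/
theorem gateValues_append_exists (gs gs' : List (Gate ℝ≥0 σ)) :
    ∃ R : List (MvPolynomial σ ℝ≥0), gateValues (gs ++ gs') = gateValues gs ++ R := by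
  induction gs' using List.reverseRecOn with
  | nil => exact ⟨[], by simp⟩
  | append_singleton gs' g ih =>
    obtain ⟨R, hR⟩ := ih
    exact ⟨R ++ [g.eval (gateValues (gs ++ gs'))], by
      rw [← List.append_assoc, gateValues_append_singleton, hR, List.append_assoc]⟩

/-- An in-range gate reference reads the same value after gates are appended. -/
theorem getD_gateValues_append (gs gs' : List (Gate ℝ≥0 σ)) {j : ℕ} (hj : j < gs.length) :
    (gateValues (gs ++ gs')).getD j 0 = (gateValues gs).getD j 0 := by
  obtain ⟨R, hR⟩ := gateValues_append_exists gs gs'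
  rw [hR, List.getD_eq_getElem?_getD, List.getD_eq_getElem?_getD,
    List.getElem?_append_left (by simpa using hj)]

/-- Availability is stable under appending gates. -/
theorem av_mono {gs : List (Gate ℝ≥0 σ)} (gs' : List (Gate ℝ≥0 σ)) {a : MvPolynomial σ ℝ≥0}
    (h : Av[gs, a]) : Av[gs ++ gs', a] := by
  obtain ⟨u, hu, hua⟩ := h
  cases u with
  | var i => exact ⟨Operand.var i, trivial, hua⟩
  | const c => exact ⟨Operand.const c, trivial, hua⟩
  | gate j =>
    simp only [Operand.RefsBelow] at hu
    refine ⟨Operand.gate j, ?_, ?_⟩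
    · simp only [Operand.RefsBelow, List.length_append]; omega
    · rw [Operand.eval_gate] at hua ⊢
      rw [getD_gateValues_append gs gs' hu]
      exact hua

/-- Variables are available. -/
theorem av_X (gs : List (Gate ℝ≥0 σ)) (i : σ) : Av[gs, (X i : MvPolynomial σ ℝ≥0)] :=
  ⟨Operand.var i, trivial, rfl⟩

/-- Constants are available. -/
theorem av_C (gs : List (Gate ℝ≥0 σ)) (c : ℝ≥0) : Av[gs, (C c : MvPolynomial σ ℝ≥0)] :=
  ⟨Operand.const c, trivial, rfl⟩

/-- `0` is available. -/
theorem av_zero (gs : List (Gate ℝ≥0 σ)) : Av[gs, (0 : MvPolynomial σ ℝ≥0)] :=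
  ⟨Operand.const 0, trivial, by simp [Operand.eval]⟩

/-- `1` is available. -/
theorem av_one (gs : List (Gate ℝ≥0 σ)) : Av[gs, (1 : MvPolynomial σ ℝ≥0)] :=
  ⟨Operand.const 1, trivial, by simp [Operand.eval]⟩

/-- The value of a freshly appended gate is available. -/
theorem av_last (gs : List (Gate ℝ≥0 σ)) (g : Gate ℝ≥0 σ) :
    Av[gs ++ [g], g.eval (gateValues gs)] := by
  refine ⟨Operand.gate gs.length, ?_, ?_⟩
  · simp only [Operand.RefsBelow, List.length_append, List.length_singleton]; omega
  · have h := gateValues_length (k := ℝ≥0) gs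
    simp only [Operand.eval_gate, gateValues_append_singleton, List.getD_eq_getElem?_getD]
    rw [← h, List.getElem?_concat_length]
    rfl

/-- Concatenation of good gate lists is good. -/
theorem good_append {gs gs' : List (Gate ℝ≥0 σ)} (h : Good[gs]) (h' : Good[gs']) :
    Good[gs ++ gs'] := by
  intro g hg
  rcases List.mem_append.mp hg with hg | hg
  exacts [h g hg, h' g hg]

/-- The empty gate list is good. -/
theorem good_nil : Good[([] : List (Gate ℝ≥0 σ))] := by
  intro g hg; simp at hg

/-- One plain sum gate makes `a + b` available. -/
theorem ext_add {gs : List (Gate ℝ≥0 σ)} (hgs : Good[gs]) {a b : MvPolynomial σ ℝ≥0}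
    (ha : Av[gs, a]) (hb : Av[gs, b]) :
    ∃ gs' : List (Gate ℝ≥0 σ), Good[gs ++ gs'] ∧ gs'.length ≤ 1 ∧ Av[gs ++ gs', a + b] := by
  obtain ⟨u, -, hua⟩ := ha
  obtain ⟨v, -, hvb⟩ := hb
  refine ⟨[Gate.sum [(1, u), (1, v)]], good_append hgs ?_, le_rfl, ?_⟩
  · intro g hg
    rw [List.mem_singleton] at hg
    subst hg
    exact ⟨by simp [Gate.fanIn, Gate.args], by simp [IsPlainGate]⟩
  · have h := av_last gs (Gate.sum [(1, u), (1, v)])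
    have he : (Gate.sum [(1, u), (1, v)]).eval (gateValues gs) = a + b := by
      simp [Gate.eval, hua, hvb]
    rwa [he] at h

/-- One product gate makes `a * b` available. -/
theorem ext_mul {gs : List (Gate ℝ≥0 σ)} (hgs : Good[gs]) {a b : MvPolynomial σ ℝ≥0}
    (ha : Av[gs, a]) (hb : Av[gs, b]) :
    ∃ gs' : List (Gate ℝ≥0 σ), Good[gs ++ gs'] ∧ gs'.length ≤ 1 ∧ Av[gs ++ gs', a * b] := by
  obtain ⟨u, -, hua⟩ := ha
  obtain ⟨v, -, hvb⟩ := hb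
  refine ⟨[Gate.prod [u, v]], good_append hgs ?_, le_rfl, ?_⟩
  · intro g hg
    rw [List.mem_singleton] at hg
    subst hg
    exact ⟨by simp [Gate.fanIn, Gate.args], by simp [IsPlainGate]⟩
  · have h := av_last gs (Gate.prod [u, v])
    have he : (Gate.prod [u, v]).eval (gateValues gs) = a * b := by
      simp [Gate.eval, hua, hvb]
    rwa [he] at h

/-- Three gates make `x * y + z * t` available. -/
theorem ext_mul_add {gs : List (Gate ℝ≥0 σ)} (hgs : Good[gs]) {x y z t : MvPolynomial σ ℝ≥0}
    (hx : Av[gs, x]) (hy : Av[gs, y]) (hz : Av[gs, z]) (ht : Av[gs, t]) :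
    ∃ gs' : List (Gate ℝ≥0 σ), Good[gs ++ gs'] ∧ gs'.length ≤ 3 ∧
      Av[gs ++ gs', x * y + z * t] := by
  obtain ⟨gs₁, hg₁, hl₁, h₁⟩ := ext_mul hgs hx hy
  obtain ⟨gs₂, hg₂, hl₂, h₂⟩ := ext_mul hg₁ (av_mono gs₁ hz) (av_mono gs₁ ht)
  obtain ⟨gs₃, hg₃, hl₃, h₃⟩ := ext_add hg₂ (av_mono gs₂ h₁) h₂
  refine ⟨gs₁ ++ gs₂ ++ gs₃, by simpa only [List.append_assoc] using hg₃, ?_, by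
    simpa only [List.append_assoc] using h₃⟩
  simp only [List.length_append]; omega

/-- Iteration: if each `G i`, `i ∈ s`, can be made available with `≤ m` new gates from any good
extension satisfying a monotone hypothesis `H`, then all of them can be made available together
with `≤ m * #s` new gates. -/
theorem ext_iter {ι : Type*} [DecidableEq ι] (s : Finset ι) (G : ι → MvPolynomial σ ℝ≥0) (m : ℕ)
    (H : List (Gate ℝ≥0 σ) → Prop) (hH : ∀ gs gs', H gs → H (gs ++ gs'))
    (hstep : ∀ gs : List (Gate ℝ≥0 σ), Good[gs] → H gs → ∀ i ∈ s,
      ∃ gs' : List (Gate ℝ≥0 σ), Good[gs ++ gs'] ∧ gs'.length ≤ m ∧ Av[gs ++ gs', G i]) :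
    ∀ gs : List (Gate ℝ≥0 σ), Good[gs] → H gs →
      ∃ gs' : List (Gate ℝ≥0 σ), Good[gs ++ gs'] ∧ gs'.length ≤ m * s.card ∧
        ∀ i ∈ s, Av[gs ++ gs', G i] := by
  induction s using Finset.induction_on with
  | empty =>
    intro gs hgs _
    exact ⟨[], by simpa using hgs, by simp, by simp⟩
  | insert a s has ih =>
    intro gs hgs hHgs
    obtain ⟨gs₁, hg₁, hl₁, hs₁⟩ :=
      ih (fun gs hgs hH i hi => hstep gs hgs hH i (Finset.mem_insert_of_mem hi)) gs hgs hHgs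
    obtain ⟨gs₂, hg₂, hl₂, hs₂⟩ :=
      hstep (gs ++ gs₁) hg₁ (hH _ _ hHgs) a (Finset.mem_insert_self a s)
    refine ⟨gs₁ ++ gs₂, by simpa only [List.append_assoc] using hg₂, ?_, ?_⟩
    · rw [List.length_append, Finset.card_insert_of_notMem has, Nat.mul_succ]; omega
    · intro i hi
      rw [← List.append_assoc]
      rcases Finset.mem_insert.mp hi with rfl | hi
      · exact hs₂
      · exact av_mono gs₂ (hs₁ i hi)

/-- A finite sum of available polynomials becomes available with `≤ #s` new gates. -/
theorem ext_sum {ι : Type*} [DecidableEq ι] (s : Finset ι) (F : ι → MvPolynomial σ ℝ≥0) :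
    ∀ gs : List (Gate ℝ≥0 σ), Good[gs] → (∀ i ∈ s, Av[gs, F i]) →
      ∃ gs' : List (Gate ℝ≥0 σ), Good[gs ++ gs'] ∧ gs'.length ≤ s.card ∧
        Av[gs ++ gs', ∑ i ∈ s, F i] := by
  induction s using Finset.induction_on with
  | empty =>
    intro gs hgs _
    exact ⟨[], by simpa using hgs, by simp, by rw [Finset.sum_empty]; exact av_zero _⟩
  | insert a s has ih =>
    intro gs hgs hav
    obtain ⟨gs₁, hg₁, hl₁, hs₁⟩ := ih gs hgs (fun i hi => hav i (Finset.mem_insert_of_mem hi))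
    have ha : Av[gs ++ gs₁, F a] := av_mono gs₁ (hav a (Finset.mem_insert_self a s))
    obtain ⟨gs₂, hg₂, hl₂, hs₂⟩ := ext_add hg₁ ha hs₁
    refine ⟨gs₁ ++ gs₂, by simpa only [List.append_assoc] using hg₂, ?_, ?_⟩
    · rw [List.length_append, Finset.card_insert_of_notMem has]; omega
    · rw [Finset.sum_insert has, ← List.append_assoc]; exact hs₂

/-- All powers `a ^ k`, `k ≤ m`, of an available polynomial become available with `≤ m` new
gates. -/
theorem ext_pow {gs : List (Gate ℝ≥0 σ)} (hgs : Good[gs]) {a : MvPolynomial σ ℝ≥0}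
    (ha : Av[gs, a]) (m : ℕ) :
    ∃ gs' : List (Gate ℝ≥0 σ), Good[gs ++ gs'] ∧ gs'.length ≤ m ∧
      ∀ k ≤ m, Av[gs ++ gs', a ^ k] := by
  induction m with
  | zero =>
    refine ⟨[], by simpa using hgs, le_rfl, fun k hk => ?_⟩
    rw [Nat.le_zero.mp hk, pow_zero]
    exact av_one _
  | succ m ih =>
    obtain ⟨gs₁, hg₁, hl₁, hs₁⟩ := ih
    obtain ⟨gs₂, hg₂, hl₂, hs₂⟩ := ext_mul hg₁ (hs₁ m le_rfl) (av_mono gs₁ ha)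
    refine ⟨gs₁ ++ gs₂, by simpa only [List.append_assoc] using hg₂, ?_, fun k hk => ?_⟩
    · rw [List.length_append]; omega
    · rw [← List.append_assoc]
      rcases Nat.of_le_succ hk with hk | rfl
      · exact av_mono gs₂ (hs₁ k hk)
      · rw [pow_succ]; exact hs₂

/-- An available polynomial is the output of a monotone computation (plain, fan-in two) of size
the number of gates. -/
theorem extract {gs : List (Gate ℝ≥0 σ)} (hgs : Good[gs]) {a : MvPolynomial σ ℝ≥0}
    (ha : Av[gs, a]) :
    ∃ P : ArithCircuit ℝ≥0 σ, IsMonotoneComputation P a ∧ P.size = gs.length := by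
  obtain ⟨u, -, hua⟩ := ha
  exact ⟨⟨gs, u⟩, ⟨fun g hg => (hgs g hg).1, fun g hg => (hgs g hg).2, hua⟩, rfl⟩

/-! ### Homogeneous components of a product -/

section HomogeneousMul

variable {R : Type*} [CommSemiring R]

/-- All homogeneous components of index `< N` sum to the polynomial once `N` exceeds the total
degree. -/
theorem sum_homogeneousComponent_of_lt (p : MvPolynomial σ R) {N : ℕ} (hN : p.totalDegree < N) :
    ∑ i ∈ Finset.range N, homogeneousComponent i p = p := by
  rw [← Finset.sum_subset (Finset.range_subset_range.mpr (Nat.succ_le_of_lt hN)), sum_homogeneousComponent]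
  intro i _ hi
  apply homogeneousComponent_eq_zero
  rw [Finset.mem_range] at hi
  omega

/-- `(φ ψ)_{i+j} = φ ψ_j` for `φ` homogeneous of degree `i`. -/
theorem homogeneousComponent_mul_left {φ ψ : MvPolynomial σ R} {i : ℕ}
    (hφ : φ.IsHomogeneous i) (j : ℕ) :
    homogeneousComponent (i + j) (φ * ψ) = φ * homogeneousComponent j ψ := by
  -- adapted from Literature/AlgebraicGeometry/Resolution/RegularLocalRingsNormal.lean
  classical
  conv_lhs => rw [← sum_homogeneousComponent ψ, Finset.mul_sum, map_sum]
  have : ∀ l ∈ Finset.range (ψ.totalDegree + 1),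
      homogeneousComponent (i + j) (φ * homogeneousComponent l ψ) =
        if l = j then φ * homogeneousComponent j ψ else 0 := by
    intro l _
    rw [homogeneousComponent_of_mem (hφ.mul (homogeneousComponent_isHomogeneous l ψ))]
    by_cases hl : l = j
    · subst hl; simp
    · have : i + j ≠ i + l := fun h => hl (by omega)
      rw [if_neg this, if_neg hl]
  rw [Finset.sum_congr rfl this, Finset.sum_ite_eq' (Finset.range (ψ.totalDegree + 1)) j]
  split_ifs with hj
  · rfl
  · rw [homogeneousComponent_eq_zero]
    · simp
    · rw [Finset.mem_range, not_lt] at hj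
      omega

/-- `(φ ψ)_n = 0` for `n < i` and `φ` homogeneous of degree `i`. -/
theorem homogeneousComponent_mul_eq_zero_of_lt {φ ψ : MvPolynomial σ R} {i n : ℕ}
    (hφ : φ.IsHomogeneous i) (hn : n < i) :
    homogeneousComponent n (φ * ψ) = 0 := by
  -- adapted from Literature/AlgebraicGeometry/Resolution/RegularLocalRingsNormal.lean
  classical
  conv_lhs => rw [← sum_homogeneousComponent ψ, Finset.mul_sum, map_sum]
  refine Finset.sum_eq_zero fun l _ => ?_
  rw [homogeneousComponent_of_mem (hφ.mul (homogeneousComponent_isHomogeneous l ψ))]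
  have : n ≠ i + l := by omega
  simp [this]

/-- **Product rule for homogeneous components**:
`(p q)_k = Σ_{a ≤ k} p_a q_{k-a}`. -/
theorem homogeneousComponent_mul_eq_sum (p q : MvPolynomial σ R) (k : ℕ) :
    homogeneousComponent k (p * q) =
      ∑ a ∈ Finset.range (k + 1),
        homogeneousComponent a p * homogeneousComponent (k - a) q := by
  classical
  have hp : ∑ i ∈ Finset.range (p.totalDegree + k + 1), homogeneousComponent i p = p :=
    sum_homogeneousComponent_of_lt p (by omega)
  calc homogeneousComponent k (p * q)
      = ∑ i ∈ Finset.range (p.totalDegree + k + 1),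
          homogeneousComponent k (homogeneousComponent i p * q) := by
        conv_lhs => rw [← hp]
        rw [Finset.sum_mul, map_sum]
    _ = ∑ i ∈ Finset.range (p.totalDegree + k + 1),
          if i ≤ k then homogeneousComponent i p * homogeneousComponent (k - i) q else 0 := by
        refine Finset.sum_congr rfl fun i _ => ?_
        split_ifs with hi
        · have h := homogeneousComponent_mul_left (ψ := q)
            (homogeneousComponent_isHomogeneous i p) (k - i)
          rwa [Nat.add_sub_of_le hi] at h
        · exact homogeneousComponent_mul_eq_zero_of_lt (homogeneousComponent_isHomogeneous i p)
            (by omega)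
    _ = ∑ i ∈ (Finset.range (p.totalDegree + k + 1)).filter (· ≤ k),
          homogeneousComponent i p * homogeneousComponent (k - i) q := by
        rw [Finset.sum_filter]
    _ = _ := by
        apply Finset.sum_congr ?_ (fun _ _ => rfl)
        ext i
        simp only [Finset.mem_filter, Finset.mem_range]
        omega

end HomogeneousMul

/-! ### Iterated extension over `k ≤ d` -/

/-- `ext_iter` over `k ≤ d`, keeping a monotone side hypothesis `A`. -/
theorem ext_family {gs : List (Gate ℝ≥0 σ)} (hgs : Good[gs]) (d m : ℕ)
    (A : List (Gate ℝ≥0 σ) → Prop) (hA : ∀ gs gs', A gs → A (gs ++ gs')) (hAgs : A gs)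
    (G : ℕ → MvPolynomial σ ℝ≥0)
    (hstep : ∀ gs' : List (Gate ℝ≥0 σ), Good[gs'] → A gs' → ∀ k ≤ d,
      ∃ gs'' : List (Gate ℝ≥0 σ), Good[gs' ++ gs''] ∧ gs''.length ≤ m ∧ Av[gs' ++ gs'', G k]) :
    ∃ gs' : List (Gate ℝ≥0 σ), Good[gs ++ gs'] ∧ gs'.length ≤ m * (d + 1) ∧ A (gs ++ gs') ∧
      ∀ k ≤ d, Av[gs ++ gs', G k] := by
  obtain ⟨gs', hg', hl', hs'⟩ := ext_iter (Finset.range (d + 1)) G m A hA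
    (fun gs' hg' hA' k hk => hstep gs' hg' hA' k
      (by have := Finset.mem_range.mp hk; omega)) gs hgs hAgs
  refine ⟨gs', hg', by simpa using hl', hA _ _ hAgs, fun k hk => hs' k ?_⟩
  exact Finset.mem_range.mpr (by omega)


end Summit.ValiantsHypothesis.ValiantsHypothesis.Theorems.CirculantFourierHrubes
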